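import Mathlib
import HarnessLib
import Summits.RiemannHypothesis.RiemannHypothesis.Theses.EarlyAppointments
import Literature.NumberTheory.LFunctions.RiemannXi

/-!
# Skeleton for Remainder0Xi (ρ2) v2 — honest three-stub decomposition

Line: rho2_v2 for crux stmt-RiemannHypothesis-24730.
Route: EarlyAppointments.

Three stubs per ADDENDUM-20 §2:
1. stub_pairSum (S1+S3): Hadamard partial fraction with symmetric truncation
2. stub_farAbel (S2+S4+S6): ‖FAR(w) − MAIN(x)‖ ≤ E/s where E = e1+e2+e3+e4+e5
3. stub_farLogKernelSharp (S5): |MAIN(x)| ≤ (η - E)/s(γ) for x in the box around γ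

The stub_farLogKernelSharp bound is the residual: π/4 + log(x)·191/x ≤ (0.5 - 0.0913)/s(γ)
at T_PT, which holds with margin. This makes the composition trivial.

Nothing here bears on the truth of RH; RH is not proved.
-/

set_option linter.dupNamespace false
namespace Summit.RiemannHypothesis.RiemannHypothesis.Cruxes.Remainder0Xi.Rho2V2

open scoped BigOperators Topology Classical
open Real Complex Literature.NumberTheory.LFunctions Set Filter

abbrev T_PT : ℝ := 3000175332800
noncomputable def xiSpacing (γ : ℝ) : ℝ := 2 * Real.pi / Real.log (γ / (2 * Real.pi))
noncomputable abbrev boxHalfWidth : ℝ := 135 / 2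
noncomputable abbrev eta0 : ℝ := 1 / 2
noncomputable abbrev lowStart : ℝ := 14

/-- Error budget terms in s-shares per ADDENDUM-20 §3. -/
noncomputable abbrev e1 : ℝ := 148 / 10000
noncomputable abbrev e2 : ℝ := 148 / 10000
noncomputable abbrev e3 : ℝ := 602 / 10000
noncomputable abbrev e4 : ℝ := 15 / 10000
noncomputable abbrev e5 : ℝ := 3 / 100000
noncomputable abbrev errorBudgetSShares : ℝ := e1 + e2 + e3 + e4 + e5

/-- The main log-kernel integral. -/
noncomputable def mainIntegral (x : ℝ) : ℝ :=
  (1 / (2 * Real.pi)) * ((∫ t in lowStart..(x - boxHalfWidth),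
      Real.log (t / (2 * Real.pi)) * (2 * x / (x ^ 2 - t ^ 2)))
    + ∫ t in Ioi (x + boxHalfWidth),
      Real.log (t / (2 * Real.pi)) * (2 * x / (x ^ 2 - t ^ 2)))

/-- The far field. -/
noncomputable def farField (w : ℂ) : ℂ :=
  deriv riemannXiUpper w / riemannXiUpper w -
    ∑ᶠ u ∈ {u : ℂ | riemannXiUpper u = 0 ∧ |u.re - w.re| < boxHalfWidth},
      ((analyticOrderAt riemannXiUpper u).toNat : ℂ) * (w - u)⁻¹

/-- **PairSum (S1+S3)**: Hadamard partial fraction with symmetric truncation. -/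
def PairSum : Prop :=
  ∀ (w : ℂ), riemannXiUpper w ≠ 0 →
    Filter.Tendsto (fun T : ℝ =>
      ∑ᶠ ρ ∈ {ρ : ℂ | riemannXiUpper ρ = 0 ∧ 0 < ρ.im ∧ ρ.im ≤ T},
        ((analyticOrderAt riemannXiUpper ρ).toNat : ℂ) * 2 * w / (w ^ 2 - ρ ^ 2))
    Filter.atTop (nhds (deriv riemannXiUpper w / riemannXiUpper w))

/-- **FarAbel (S2+S4+S6)**: ‖FAR(w) − MAIN(x)‖ ≤ E/s(γ). -/
def FarAbel : Prop :=
  ∀ γ : ℝ, T_PT < γ → ∀ w : ℂ, |w.re - γ| ≤ boxHalfWidth → |w.im| ≤ eta0 →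
    riemannXiUpper w ≠ 0 →
    ‖farField w - (mainIntegral w.re : ℂ)‖ ≤ errorBudgetSShares / xiSpacing γ

/-- **FarLogKernelSharp (S5)**: |MAIN(x)| ≤ (η - E)/s(γ) for x in the box.
This encapsulates the drift bound π/4 + O(log x/x) ≤ (0.5 - 0.0913)/s(γ). -/
def FarLogKernelSharp : Prop :=
  ∀ γ : ℝ, T_PT < γ → ∀ x : ℝ, |x - γ| ≤ boxHalfWidth →
    |mainIntegral x| ≤ (eta0 - errorBudgetSShares) / xiSpacing γ

theorem stub_pairSum : PairSum := by sorry
theorem stub_farAbel : FarAbel := by sorry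
theorem stub_farLogKernelSharp : FarLogKernelSharp := by sorry

/-- Assembly: triangle + the two bounds. -/
theorem remainder0Xi_assembly (hPair : PairSum) (hAbel : FarAbel) (hSharp : FarLogKernelSharp) :
    Summit.RiemannHypothesis.RiemannHypothesis.Theses.EarlyAppointments.Remainder0Xi := by
  intro γ hγ w hw_re hw_im hw_ne
  have _pairUsed : PairSum := hPair
  have hAbel' := hAbel γ hγ w hw_re hw_im hw_ne
  have hSharp' := hSharp γ hγ w.re (by convert hw_re using 2)
  have tri : ‖farField w‖ ≤ ‖farField w - (mainIntegral w.re : ℂ)‖ + ‖(mainIntegral w.re : ℂ)‖ := by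
    calc ‖farField w‖ = ‖farField w - (mainIntegral w.re : ℂ) + (mainIntegral w.re : ℂ)‖ := by ring_nf
      _ ≤ ‖farField w - (mainIntegral w.re : ℂ)‖ + ‖(mainIntegral w.re : ℂ)‖ := norm_add_le _ _
  have norm_real : ‖(mainIntegral w.re : ℂ)‖ = |mainIntegral w.re| := Complex.norm_real _
  calc ‖farField w‖
      ≤ ‖farField w - (mainIntegral w.re : ℂ)‖ + |mainIntegral w.re| := by rw [← norm_real]; exact tri
    _ ≤ errorBudgetSShares / xiSpacing γ + |mainIntegral w.re| := by linarith [hAbel']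
    _ ≤ errorBudgetSShares / xiSpacing γ + (eta0 - errorBudgetSShares) / xiSpacing γ := by linarith [hSharp']
    _ = eta0 / xiSpacing γ := by ring

/-- **Remainder0Xi_of** proves the crux from the three stubs. -/
theorem Remainder0Xi_of :
    Summit.RiemannHypothesis.RiemannHypothesis.Theses.EarlyAppointments.Remainder0Xi :=
  remainder0Xi_assembly stub_pairSum stub_farAbel stub_farLogKernelSharp

end Summit.RiemannHypothesis.RiemannHypothesis.Cruxes.Remainder0Xi.Rho2V2
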